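import Summits.BirchSwinnertonDyer.BirchSwinnertonDyer.Theorems.KolyvaginDepthDoorDepthTableRowsExactReadingZhang1
import Summits.BirchSwinnertonDyer.BirchSwinnertonDyer.Theorems.KolyvaginDepthDoorDepthTableRowsExactReadingZhang2
import Summits.BirchSwinnertonDyer.BirchSwinnertonDyer.Theorems.Rank2Observatory433a1TwoDescClRankTwo
import Summits.BirchSwinnertonDyer.BirchSwinnertonDyer.Theorems.Rank2Observatory563a1TwoDescClRankTwo
import Summits.BirchSwinnertonDyer.BirchSwinnertonDyer.Theorems.Rank2Observatory571b1TwoDescClRankTwo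
import Summits.BirchSwinnertonDyer.BirchSwinnertonDyer.Theorems.Rank2Observatory643a1TwoDescClRankTwo
import Summits.BirchSwinnertonDyer.BirchSwinnertonDyer.Theorems.Rank2Observatory681c1TwoDescRankTwo
import HarnessLib

/-!
# Route `KolyvaginDepthDoor`, crux `KolyvaginDepthSupplyKN` (stmt-BirchSwinnertonDyer-22820) —
# DEPTH TABLE v11: THE `rank E(ℚ) = 2` CONJUNCT DISCHARGED BY THE TREE'S KERNEL 2-DESCENT
# CERTIFICATES (5 rows: `433a1`, `563a1`, `571b1`, `643a1`, `681c1`) — the bit is «`Ш(E)[p] = 0` ∧ `#Sel_p(E^{(d_K)}) ≤ p`» and nothing else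

Helper file of the lead prover of line `levelone` (kdd-p1 g15; `--supports stmt-BirchSwinnertonDyer-22820
--as helper`); it closes nothing and BSD is not proved by it.

The v10 depth table (g14, files `KolyvaginDepthDoorDepthTableRowsExactReading{,Zhang1,Zhang2,Zhang3,944e1}`)
reads every rank-2 row EXACTLY but with the rank in the answer: per curve, for ANY imaginary quadratic `K`
with the row's `d_K`, «∃ frame, Kolyvagin prime `ℓ`, datum: `c_1(ℓ) ≠ 0`» `↔` «`rank E(ℚ) = 2` ∧
`Ш(E/ℚ)[p] = 0` ∧ `#Sel_p(E^{(d_K)}/ℚ) ≤ p`» — the lower bound `2 ≤ rank` being the kernel certificate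
`Rank2ObservatoryKernelCerts*.C<label>.two_le_rank` and the upper bound left inside the statement («no
2-descent»). The tree HOLDS the upper bound: the rank-≥-2 observatory's general 2-descent over the cubic
`2`-division field, kernel-checked per curve (`Rank2Observatory<label>TwoDesc(Cl)RankTwo.mordellWeilRank_eq_two`,
Cassels' `x − θ` map into `K(S,2)`, norm-square-residue and three-real-place sieves, `decide` only; for
`433a1`, `563a1`, `571b1`, `643a1` through the class-group certificate `…TwoDescClCert1`). Feeding it in
removes the rank from the answer. RESULT, per row, for ANY `K` with the listed `d_K`:

  «∃ frame, Kolyvagin prime `ℓ`, datum of conductor `ℓ` with `c_1(ℓ) ≠ 0`»  `↔`  «`Ш(E/ℚ)[p] = 0` ∧ `#Sel_p(E^{(d_K)}/ℚ) ≤ p`»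

— ONE COMPUTED BIT (Jetchev–Lauter–Stein's algorithm) IS EXACTLY «`Ш(E)[p] = 0` and the Heegner twist's
`p`-Selmer group has order `≤ p`» (equivalently `dim_𝔽ₚ Sel_p(E^{(d_K)}/ℚ) ≤ 1`), with NO rank, no `hF`, no
twist point, no twist pinning and no `Ш`-hypothesis left in the statement. Every per-curve side condition
(`p` good ordinary, `ρ_{E,p^n}` onto, non-CM, ♠ (1) + semistability, Kodaira–Néron table, Heegner
hypothesis by Kronecker symbols, `rank E(ℚ) = 2`) is a kernel theorem of the tree. CONDITIONAL on the two
named print facts (γ) = Gross 1991 Prop. 3.7 (2) and W. Zhang 2014 Lemma 8.4 (1) / Thm. 9.1; per curve;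
BSD is NOT proved by any of this.

Rows treated here: `433a1` `(5, −8)`; `563a1` `(5, −8)`; `571b1` `(5, −8)`; `643a1` `(5, −8)`; `681c1` `(5, −83)`. (The other rows wait for their 2-descent modules to be built on the farm;
`794a1`, `997b1`, `997c1` have no 2-descent certificate in the tree yet.)

References: [WZhang2014] Lemma 8.4 (1) (p. 236), Thm. 9.1 (p. 240); [GrossLMS1991] Prop. 3.7 (2);
[JetchevLauterStein2009] §3.6 (arXiv:0707.0032); [Cassels1991LecturesEllipticCurves] §15 (2-descent);
[CremonaAlgorithms1997] Table 1, §3.6.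
-/

set_option linter.dupNamespace false

noncomputable section

open scoped Classical NumberField

namespace Summit.BirchSwinnertonDyer.BirchSwinnertonDyer.Theorems.KolyvaginDepthDoor

open Literature.NumberTheory.EllipticCurves Literature.NumberTheory.EllipticCurves.ModularForms
  WeierstrassCurve NumberField IsDedekindDomain
open Summit.BirchSwinnertonDyer.BirchSwinnertonDyer.Theorems
open Summit.BirchSwinnertonDyer.BirchSwinnertonDyer.Rank2Observatory

/-! ## `433a1 = [1, 0, 0, 0, 1]` at `(p, d_K) = (5, -8)` (N = 433 prime; `Δ = -433`; `5` inert; rank certificate `Rank2Observatory433a1TwoDescClRankTwo`) -/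

namespace C433a1

/-- **DEPTH-TABLE ROW `433a1`, `(p, d_K) = (5, −8)`, v11 — RANK DISCHARGED.** For `E = 433a1` and ANY
imaginary quadratic `K` with `d_K = −8`: «some frame, some Kolyvagin prime `ℓ`, some datum of conductor `ℓ`
with `c_1(ℓ) ≠ 0`» `↔` «`Ш(E/ℚ)[5] = 0` ∧ `#Sel_5(E^{(−8)}/ℚ) ≤ 5`». From the v10 row
`C433a1.exactRowZhang_5_neg8` (answer `rank = 2 ∧ …`) and the tree's kernel 2-descent certificate
`Rank2Observatory.C433a1.mordellWeilRank_eq_two` (ClCert1 + ClRankTwo (cubic field with non-trivial class group)). Every side condition is a kernel theorem;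
CONDITIONAL on (γ) and W. Zhang's Lemma 8.4 (1) / Thm. 9.1 by name; per curve; BSD is not proved by it.
[cite: WZhang2014, Lemma 8.4 (1) (p. 236), Thm. 9.1 (p. 240)] [cite: GrossLMS1991, Prop. 3.7 (2)]
[cite: Cassels1991LecturesEllipticCurves, §15] [cite: CremonaAlgorithms1997, Table 1 (433a1), §3.6] -/
theorem exactRowZhang_5_neg8_rankFree
    (h372 : GrossLMS1991.prop37_2_frobeniusCongruence)
    (h84 : Literature.NumberTheory.EllipticCurves.WZhang2014_lemma84_exists_minimal_kolyvaginClass_one_selmerCard)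
    (K : Type) [Field K] [NumberField K] (hK : IsImaginaryQuadratic K)
    (hD : NumberField.discr K = -8) :
    haveI := isElliptic_c433a1;
    haveI := isGloballyMinimal_c433a1;
    haveI : NeZero (((⟨1, 0, 0, 0, 1⟩ : WeierstrassCurve ℤ).map (Int.castRingHom ℚ)).conductorNorm ℤ) := neZero_conductorNorm_of_isElliptic _;
    haveI := Fact.mk (by norm_num : Nat.Prime 5);
    (∃ (Dt : ModularParametrizationData ((⟨1, 0, 0, 0, 1⟩ : WeierstrassCurve ℤ).map (Int.castRingHom ℚ)) (((⟨1, 0, 0, 0, 1⟩ : WeierstrassCurve ℤ).map (Int.castRingHom ℚ)).conductorNorm ℤ)) (β : ℤ)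
      (ι : K →+* ℂ) (ℓ : ℕ) (d : KolyvaginHeegnerData Dt β ι ℓ),
      ℓ.Prime ∧ Zhang2014.IsKolyvaginPrime (((⟨1, 0, 0, 0, 1⟩ : WeierstrassCurve ℤ).map (Int.castRingHom ℚ)).conductorNorm ℤ) ((⟨1, 0, 0, 0, 1⟩ : WeierstrassCurve ℤ).map (Int.castRingHom ℚ)) K 5 ℓ ∧
        d.kolyvaginClass (p := 5) (by norm_num) 1 ≠ 0) ↔
    ((((⟨1, 0, 0, 0, 1⟩ : WeierstrassCurve ℤ).map (Int.castRingHom ℚ)).sha ⊓ AddSubgroup.torsionBy ((⟨1, 0, 0, 0, 1⟩ : WeierstrassCurve ℤ).map (Int.castRingHom ℚ)).galH1 ((5 : ℕ) : ℤ) : AddSubgroup _) = ⊥ ∧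
      Nat.card ((((⟨1, 0, 0, 0, 1⟩ : WeierstrassCurve ℤ).map (Int.castRingHom ℚ)).quadraticTwist (NumberField.discr K : ℚ)).selmerGroup (5 : ℕ)) ≤ 5) := by
  haveI := isElliptic_c433a1
  haveI := isGloballyMinimal_c433a1
  haveI : NeZero (((⟨1, 0, 0, 0, 1⟩ : WeierstrassCurve ℤ).map (Int.castRingHom ℚ)).conductorNorm ℤ) := neZero_conductorNorm_of_isElliptic _
  haveI := Fact.mk (by norm_num : Nat.Prime 5)
  exact (exactRowZhang_5_neg8 h372 h84 K hK hD).trans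
    (and_iff_right Summit.BirchSwinnertonDyer.BirchSwinnertonDyer.Rank2Observatory.C433a1.mordellWeilRank_eq_two)

end C433a1

/-! ## `563a1 = [1, 1, 1, -15, 16]` at `(p, d_K) = (5, -8)` (N = 563 prime; `Δ = -563`; `5` inert; rank certificate `Rank2Observatory563a1TwoDescClRankTwo`) -/

namespace C563a1

/-- **DEPTH-TABLE ROW `563a1`, `(p, d_K) = (5, −8)`, v11 — RANK DISCHARGED.** For `E = 563a1` and ANY
imaginary quadratic `K` with `d_K = −8`: «some frame, some Kolyvagin prime `ℓ`, some datum of conductor `ℓ`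
with `c_1(ℓ) ≠ 0`» `↔` «`Ш(E/ℚ)[5] = 0` ∧ `#Sel_5(E^{(−8)}/ℚ) ≤ 5`». From the v10 row
`C563a1.exactRowZhang_5_neg8` (answer `rank = 2 ∧ …`) and the tree's kernel 2-descent certificate
`Rank2Observatory.C563a1.mordellWeilRank_eq_two` (ClCert1 + ClRankTwo). Every side condition is a kernel theorem;
CONDITIONAL on (γ) and W. Zhang's Lemma 8.4 (1) / Thm. 9.1 by name; per curve; BSD is not proved by it.
[cite: WZhang2014, Lemma 8.4 (1) (p. 236), Thm. 9.1 (p. 240)] [cite: GrossLMS1991, Prop. 3.7 (2)]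
[cite: Cassels1991LecturesEllipticCurves, §15] [cite: CremonaAlgorithms1997, Table 1 (563a1), §3.6] -/
theorem exactRowZhang_5_neg8_rankFree
    (h372 : GrossLMS1991.prop37_2_frobeniusCongruence)
    (h84 : Literature.NumberTheory.EllipticCurves.WZhang2014_lemma84_exists_minimal_kolyvaginClass_one_selmerCard)
    (K : Type) [Field K] [NumberField K] (hK : IsImaginaryQuadratic K)
    (hD : NumberField.discr K = -8) :
    haveI := isElliptic_c563a1;
    haveI := isGloballyMinimal_c563a1;
    haveI : NeZero (((⟨1, 1, 1, -15, 16⟩ : WeierstrassCurve ℤ).map (Int.castRingHom ℚ)).conductorNorm ℤ) := neZero_conductorNorm_of_isElliptic _;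
    haveI := Fact.mk (by norm_num : Nat.Prime 5);
    (∃ (Dt : ModularParametrizationData ((⟨1, 1, 1, -15, 16⟩ : WeierstrassCurve ℤ).map (Int.castRingHom ℚ)) (((⟨1, 1, 1, -15, 16⟩ : WeierstrassCurve ℤ).map (Int.castRingHom ℚ)).conductorNorm ℤ)) (β : ℤ)
      (ι : K →+* ℂ) (ℓ : ℕ) (d : KolyvaginHeegnerData Dt β ι ℓ),
      ℓ.Prime ∧ Zhang2014.IsKolyvaginPrime (((⟨1, 1, 1, -15, 16⟩ : WeierstrassCurve ℤ).map (Int.castRingHom ℚ)).conductorNorm ℤ) ((⟨1, 1, 1, -15, 16⟩ : WeierstrassCurve ℤ).map (Int.castRingHom ℚ)) K 5 ℓ ∧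
        d.kolyvaginClass (p := 5) (by norm_num) 1 ≠ 0) ↔
    ((((⟨1, 1, 1, -15, 16⟩ : WeierstrassCurve ℤ).map (Int.castRingHom ℚ)).sha ⊓ AddSubgroup.torsionBy ((⟨1, 1, 1, -15, 16⟩ : WeierstrassCurve ℤ).map (Int.castRingHom ℚ)).galH1 ((5 : ℕ) : ℤ) : AddSubgroup _) = ⊥ ∧
      Nat.card ((((⟨1, 1, 1, -15, 16⟩ : WeierstrassCurve ℤ).map (Int.castRingHom ℚ)).quadraticTwist (NumberField.discr K : ℚ)).selmerGroup (5 : ℕ)) ≤ 5) := by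
  haveI := isElliptic_c563a1
  haveI := isGloballyMinimal_c563a1
  haveI : NeZero (((⟨1, 1, 1, -15, 16⟩ : WeierstrassCurve ℤ).map (Int.castRingHom ℚ)).conductorNorm ℤ) := neZero_conductorNorm_of_isElliptic _
  haveI := Fact.mk (by norm_num : Nat.Prime 5)
  exact (exactRowZhang_5_neg8 h372 h84 K hK hD).trans
    (and_iff_right Summit.BirchSwinnertonDyer.BirchSwinnertonDyer.Rank2Observatory.C563a1.mordellWeilRank_eq_two)

end C563a1

/-! ## `571b1 = [0, 1, 1, -4, 2]` at `(p, d_K) = (5, -8)` (N = 571 prime; `Δ = -571`; `5` inert; rank certificate `Rank2Observatory571b1TwoDescClRankTwo`) -/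

namespace C571b1

/-- **DEPTH-TABLE ROW `571b1`, `(p, d_K) = (5, −8)`, v11 — RANK DISCHARGED.** For `E = 571b1` and ANY
imaginary quadratic `K` with `d_K = −8`: «some frame, some Kolyvagin prime `ℓ`, some datum of conductor `ℓ`
with `c_1(ℓ) ≠ 0`» `↔` «`Ш(E/ℚ)[5] = 0` ∧ `#Sel_5(E^{(−8)}/ℚ) ≤ 5`». From the v10 row
`C571b1.exactRowZhang_5_neg8` (answer `rank = 2 ∧ …`) and the tree's kernel 2-descent certificate
`Rank2Observatory.C571b1.mordellWeilRank_eq_two` (ClCert1 + ClRankTwo). Every side condition is a kernel theorem;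
CONDITIONAL on (γ) and W. Zhang's Lemma 8.4 (1) / Thm. 9.1 by name; per curve; BSD is not proved by it.
[cite: WZhang2014, Lemma 8.4 (1) (p. 236), Thm. 9.1 (p. 240)] [cite: GrossLMS1991, Prop. 3.7 (2)]
[cite: Cassels1991LecturesEllipticCurves, §15] [cite: CremonaAlgorithms1997, Table 1 (571b1), §3.6] -/
theorem exactRowZhang_5_neg8_rankFree
    (h372 : GrossLMS1991.prop37_2_frobeniusCongruence)
    (h84 : Literature.NumberTheory.EllipticCurves.WZhang2014_lemma84_exists_minimal_kolyvaginClass_one_selmerCard)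
    (K : Type) [Field K] [NumberField K] (hK : IsImaginaryQuadratic K)
    (hD : NumberField.discr K = -8) :
    haveI := isElliptic_c571b1;
    haveI := isGloballyMinimal_c571b1;
    haveI : NeZero (((⟨0, 1, 1, -4, 2⟩ : WeierstrassCurve ℤ).map (Int.castRingHom ℚ)).conductorNorm ℤ) := neZero_conductorNorm_of_isElliptic _;
    haveI := Fact.mk (by norm_num : Nat.Prime 5);
    (∃ (Dt : ModularParametrizationData ((⟨0, 1, 1, -4, 2⟩ : WeierstrassCurve ℤ).map (Int.castRingHom ℚ)) (((⟨0, 1, 1, -4, 2⟩ : WeierstrassCurve ℤ).map (Int.castRingHom ℚ)).conductorNorm ℤ)) (β : ℤ)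
      (ι : K →+* ℂ) (ℓ : ℕ) (d : KolyvaginHeegnerData Dt β ι ℓ),
      ℓ.Prime ∧ Zhang2014.IsKolyvaginPrime (((⟨0, 1, 1, -4, 2⟩ : WeierstrassCurve ℤ).map (Int.castRingHom ℚ)).conductorNorm ℤ) ((⟨0, 1, 1, -4, 2⟩ : WeierstrassCurve ℤ).map (Int.castRingHom ℚ)) K 5 ℓ ∧
        d.kolyvaginClass (p := 5) (by norm_num) 1 ≠ 0) ↔
    ((((⟨0, 1, 1, -4, 2⟩ : WeierstrassCurve ℤ).map (Int.castRingHom ℚ)).sha ⊓ AddSubgroup.torsionBy ((⟨0, 1, 1, -4, 2⟩ : WeierstrassCurve ℤ).map (Int.castRingHom ℚ)).galH1 ((5 : ℕ) : ℤ) : AddSubgroup _) = ⊥ ∧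
      Nat.card ((((⟨0, 1, 1, -4, 2⟩ : WeierstrassCurve ℤ).map (Int.castRingHom ℚ)).quadraticTwist (NumberField.discr K : ℚ)).selmerGroup (5 : ℕ)) ≤ 5) := by
  haveI := isElliptic_c571b1
  haveI := isGloballyMinimal_c571b1
  haveI : NeZero (((⟨0, 1, 1, -4, 2⟩ : WeierstrassCurve ℤ).map (Int.castRingHom ℚ)).conductorNorm ℤ) := neZero_conductorNorm_of_isElliptic _
  haveI := Fact.mk (by norm_num : Nat.Prime 5)
  exact (exactRowZhang_5_neg8 h372 h84 K hK hD).trans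
    (and_iff_right Summit.BirchSwinnertonDyer.BirchSwinnertonDyer.Rank2Observatory.C571b1.mordellWeilRank_eq_two)

end C571b1

/-! ## `643a1 = [1, 0, 0, -4, 3]` at `(p, d_K) = (5, -8)` (N = 643 prime; `Δ = -643`; `5` inert; rank certificate `Rank2Observatory643a1TwoDescClRankTwo`) -/

namespace C643a1

/-- **DEPTH-TABLE ROW `643a1`, `(p, d_K) = (5, −8)`, v11 — RANK DISCHARGED.** For `E = 643a1` and ANY
imaginary quadratic `K` with `d_K = −8`: «some frame, some Kolyvagin prime `ℓ`, some datum of conductor `ℓ`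
with `c_1(ℓ) ≠ 0`» `↔` «`Ш(E/ℚ)[5] = 0` ∧ `#Sel_5(E^{(−8)}/ℚ) ≤ 5`». From the v10 row
`C643a1.exactRowZhang_5_neg8` (answer `rank = 2 ∧ …`) and the tree's kernel 2-descent certificate
`Rank2Observatory.C643a1.mordellWeilRank_eq_two` (ClCert1 + ClRankTwo). Every side condition is a kernel theorem;
CONDITIONAL on (γ) and W. Zhang's Lemma 8.4 (1) / Thm. 9.1 by name; per curve; BSD is not proved by it.
[cite: WZhang2014, Lemma 8.4 (1) (p. 236), Thm. 9.1 (p. 240)] [cite: GrossLMS1991, Prop. 3.7 (2)]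
[cite: Cassels1991LecturesEllipticCurves, §15] [cite: CremonaAlgorithms1997, Table 1 (643a1), §3.6] -/
theorem exactRowZhang_5_neg8_rankFree
    (h372 : GrossLMS1991.prop37_2_frobeniusCongruence)
    (h84 : Literature.NumberTheory.EllipticCurves.WZhang2014_lemma84_exists_minimal_kolyvaginClass_one_selmerCard)
    (K : Type) [Field K] [NumberField K] (hK : IsImaginaryQuadratic K)
    (hD : NumberField.discr K = -8) :
    haveI := isElliptic_c643a1;
    haveI := isGloballyMinimal_c643a1;
    haveI : NeZero (((⟨1, 0, 0, -4, 3⟩ : WeierstrassCurve ℤ).map (Int.castRingHom ℚ)).conductorNorm ℤ) := neZero_conductorNorm_of_isElliptic _;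
    haveI := Fact.mk (by norm_num : Nat.Prime 5);
    (∃ (Dt : ModularParametrizationData ((⟨1, 0, 0, -4, 3⟩ : WeierstrassCurve ℤ).map (Int.castRingHom ℚ)) (((⟨1, 0, 0, -4, 3⟩ : WeierstrassCurve ℤ).map (Int.castRingHom ℚ)).conductorNorm ℤ)) (β : ℤ)
      (ι : K →+* ℂ) (ℓ : ℕ) (d : KolyvaginHeegnerData Dt β ι ℓ),
      ℓ.Prime ∧ Zhang2014.IsKolyvaginPrime (((⟨1, 0, 0, -4, 3⟩ : WeierstrassCurve ℤ).map (Int.castRingHom ℚ)).conductorNorm ℤ) ((⟨1, 0, 0, -4, 3⟩ : WeierstrassCurve ℤ).map (Int.castRingHom ℚ)) K 5 ℓ ∧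
        d.kolyvaginClass (p := 5) (by norm_num) 1 ≠ 0) ↔
    ((((⟨1, 0, 0, -4, 3⟩ : WeierstrassCurve ℤ).map (Int.castRingHom ℚ)).sha ⊓ AddSubgroup.torsionBy ((⟨1, 0, 0, -4, 3⟩ : WeierstrassCurve ℤ).map (Int.castRingHom ℚ)).galH1 ((5 : ℕ) : ℤ) : AddSubgroup _) = ⊥ ∧
      Nat.card ((((⟨1, 0, 0, -4, 3⟩ : WeierstrassCurve ℤ).map (Int.castRingHom ℚ)).quadraticTwist (NumberField.discr K : ℚ)).selmerGroup (5 : ℕ)) ≤ 5) := by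
  haveI := isElliptic_c643a1
  haveI := isGloballyMinimal_c643a1
  haveI : NeZero (((⟨1, 0, 0, -4, 3⟩ : WeierstrassCurve ℤ).map (Int.castRingHom ℚ)).conductorNorm ℤ) := neZero_conductorNorm_of_isElliptic _
  haveI := Fact.mk (by norm_num : Nat.Prime 5)
  exact (exactRowZhang_5_neg8 h372 h84 K hK hD).trans
    (and_iff_right Summit.BirchSwinnertonDyer.BirchSwinnertonDyer.Rank2Observatory.C643a1.mordellWeilRank_eq_two)

end C643a1

/-! ## `681c1 = [0, -1, 1, 0, 2]` at `(p, d_K) = (5, -83)` (N = 3·227; `Δ = -2043`; `5` inert; rank certificate `Rank2Observatory681c1TwoDescRankTwo`) -/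

namespace C681c1

/-- **DEPTH-TABLE ROW `681c1`, `(p, d_K) = (5, −83)`, v11 — RANK DISCHARGED.** For `E = 681c1` and ANY
imaginary quadratic `K` with `d_K = −83`: «some frame, some Kolyvagin prime `ℓ`, some datum of conductor `ℓ`
with `c_1(ℓ) ≠ 0`» `↔` «`Ш(E/ℚ)[5] = 0` ∧ `#Sel_5(E^{(−83)}/ℚ) ≤ 5`». From the v10 row
`C681c1.exactRowZhang_5_neg83` (answer `rank = 2 ∧ …`) and the tree's kernel 2-descent certificate
`Rank2Observatory.C681c1.mordellWeilRank_eq_two` (TwoDescRankTwo). Every side condition is a kernel theorem;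
CONDITIONAL on (γ) and W. Zhang's Lemma 8.4 (1) / Thm. 9.1 by name; per curve; BSD is not proved by it.
[cite: WZhang2014, Lemma 8.4 (1) (p. 236), Thm. 9.1 (p. 240)] [cite: GrossLMS1991, Prop. 3.7 (2)]
[cite: Cassels1991LecturesEllipticCurves, §15] [cite: CremonaAlgorithms1997, Table 1 (681c1), §3.6] -/
theorem exactRowZhang_5_neg83_rankFree
    (h372 : GrossLMS1991.prop37_2_frobeniusCongruence)
    (h84 : Literature.NumberTheory.EllipticCurves.WZhang2014_lemma84_exists_minimal_kolyvaginClass_one_selmerCard)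
    (K : Type) [Field K] [NumberField K] (hK : IsImaginaryQuadratic K)
    (hD : NumberField.discr K = -83) :
    haveI := isElliptic_c681c1;
    haveI := isGloballyMinimal_c681c1;
    haveI : NeZero (((⟨0, -1, 1, 0, 2⟩ : WeierstrassCurve ℤ).map (Int.castRingHom ℚ)).conductorNorm ℤ) := neZero_conductorNorm_of_isElliptic _;
    haveI := Fact.mk (by norm_num : Nat.Prime 5);
    (∃ (Dt : ModularParametrizationData ((⟨0, -1, 1, 0, 2⟩ : WeierstrassCurve ℤ).map (Int.castRingHom ℚ)) (((⟨0, -1, 1, 0, 2⟩ : WeierstrassCurve ℤ).map (Int.castRingHom ℚ)).conductorNorm ℤ)) (β : ℤ)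
      (ι : K →+* ℂ) (ℓ : ℕ) (d : KolyvaginHeegnerData Dt β ι ℓ),
      ℓ.Prime ∧ Zhang2014.IsKolyvaginPrime (((⟨0, -1, 1, 0, 2⟩ : WeierstrassCurve ℤ).map (Int.castRingHom ℚ)).conductorNorm ℤ) ((⟨0, -1, 1, 0, 2⟩ : WeierstrassCurve ℤ).map (Int.castRingHom ℚ)) K 5 ℓ ∧
        d.kolyvaginClass (p := 5) (by norm_num) 1 ≠ 0) ↔
    ((((⟨0, -1, 1, 0, 2⟩ : WeierstrassCurve ℤ).map (Int.castRingHom ℚ)).sha ⊓ AddSubgroup.torsionBy ((⟨0, -1, 1, 0, 2⟩ : WeierstrassCurve ℤ).map (Int.castRingHom ℚ)).galH1 ((5 : ℕ) : ℤ) : AddSubgroup _) = ⊥ ∧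
      Nat.card ((((⟨0, -1, 1, 0, 2⟩ : WeierstrassCurve ℤ).map (Int.castRingHom ℚ)).quadraticTwist (NumberField.discr K : ℚ)).selmerGroup (5 : ℕ)) ≤ 5) := by
  haveI := isElliptic_c681c1
  haveI := isGloballyMinimal_c681c1
  haveI : NeZero (((⟨0, -1, 1, 0, 2⟩ : WeierstrassCurve ℤ).map (Int.castRingHom ℚ)).conductorNorm ℤ) := neZero_conductorNorm_of_isElliptic _
  haveI := Fact.mk (by norm_num : Nat.Prime 5)
  exact (exactRowZhang_5_neg83 h372 h84 K hK hD).trans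
    (and_iff_right Summit.BirchSwinnertonDyer.BirchSwinnertonDyer.Rank2Observatory.C681c1.mordellWeilRank_eq_two)

end C681c1

end Summit.BirchSwinnertonDyer.BirchSwinnertonDyer.Theorems.KolyvaginDepthDoor

end
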